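import Mathlib
import Literature.NumberTheory.Transcendental.PeriodsWave0
import Summits.KontsevichZagierPeriods.KontsevichZagierPeriods.Theorems.SoloInformedTorusBoxLogic
import Summits.KontsevichZagierPeriods.KontsevichZagierPeriods.Theorems.SoloInformedTorusBoxLoc
import HarnessLib
import HarnessLib.Audit

/-!
# SoloInformed — the Theorem II instance under the four exponentials conjecture

The open transcendence content of volume rung `3` on the torus/box instance is the statement
`SoloInformedC4EW23` ("`p·π² ≠ q·log 2·log 3` for `p, q ≥ 1`", the case `(2,3)` of the weak
four-exponentials conjecture (C4EW) of Nesterenko–Philippon, LNM 1752, Ch. 2 §4.1). This file places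
it UNDER a registered standard conjecture of the Literature library: the four exponentials conjecture
`Literature.NumberTheory.Transcendental.FourExponentialsConjecture` (Schneider 1957 / Lang 1966 /
Ramachandra 1968; `PeriodsWave0.lean`, periods.S14) implies `SoloInformedC4EW23`
(`soloInformed_c4ew23_of_fourExponentials`): with `x = (log 2, iπ)` and `y = (1, iπ / log 2)` (both
pairs `ℚ`-linearly independent, one entry being real and the other purely imaginary) the four
exponentials are `2, −1, −1, e^{−π²/log 2}`, and a relation `p·π² = q·log 2·log 3` would make the last
one `3^{−q/p}`, algebraic. Consequences recorded: the four exponentials conjecture implies the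
non-relations `SoloInformedTorusBoxNoRelation` / `SoloInformedTorusBoxNoLocRelation` of the calculus
(kernel, via `soloInformed_noRelation_of_c4ew`, `soloInformed_noLocRelation_of_c4ew`), so on this
instance volume rung `3` asks for nothing beyond Schanuel-type conjectures; conversely the instance is
decided by no theorem in print (the weak four-exponentials statement is open).

Residency `solo-KontsevichZagierPeriods-informed` (PLAN.md, session s17).
References: M. Waldschmidt, in *Surveys in Number Theory* (2008), Conjecture 12; Yu. Nesterenko,
P. Philippon (eds.), LNM 1752 (2001), Ch. 2 §4.1–4.2; M. Kontsevich, D. Zagier, *Periods* (2001), §1.2.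
-/

noncomputable section

namespace Summit.KontsevichZagierPeriods.KontsevichZagierPeriods.Theorems

open Literature.NumberTheory.Transcendental Literature.NumberTheory.Transcendental.KZ Complex

/-- A pair `(a, b·i)` with `a, b` real and non-zero is `ℚ`-linearly independent in `ℂ`. -/
theorem soloInformed_linearIndependent_real_imaginary (a b : ℝ) (ha : a ≠ 0) (hb : b ≠ 0) :
    LinearIndependent ℚ ![(a : ℂ), (b : ℂ) * I] := by
  refine LinearIndependent.pair_iff.2 fun s t hst => ?_
  have hre := congrArg Complex.re hst
  have him := congrArg Complex.im hst
  simp only [Rat.smul_def, Complex.add_re, Complex.mul_re, Complex.ratCast_re, Complex.ofReal_re,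
    Complex.ratCast_im, Complex.ofReal_im, Complex.I_re, Complex.I_im, Complex.mul_im,
    Complex.zero_re, Complex.zero_im, Complex.add_im] at hre him
  constructor
  · have h : (s : ℝ) * a = 0 := by nlinarith [hre]
    rcases mul_eq_zero.1 h with h | h
    · exact_mod_cast h
    · exact (ha h).elim
  · have h : (t : ℝ) * b = 0 := by nlinarith [him]
    rcases mul_eq_zero.1 h with h | h
    · exact_mod_cast h
    · exact (hb h).elim

/-- A real number with a rational positive power is algebraic (as a complex number). -/
theorem soloInformed_isAlgebraic_of_pow_eq_ratCast (t : ℝ) (p : ℕ) (hp : p ≠ 0) (c : ℚ)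
    (h : t ^ p = c) : IsAlgebraic ℚ (t : ℂ) := by
  refine IsAlgebraic.of_pow (Nat.pos_of_ne_zero hp) ?_
  rw [← Complex.ofReal_pow, h]
  simpa using isAlgebraic_algebraMap (R := ℚ) (A := ℂ) c

/-- `e^{iπ} = −1` is algebraic. -/
theorem soloInformed_isAlgebraic_exp_pi_mul_I : IsAlgebraic ℚ (cexp (Real.pi * I)) := by
  rw [Complex.exp_pi_mul_I]
  simpa using isAlgebraic_algebraMap (R := ℚ) (A := ℂ) (-1)

/-- **The four exponentials conjecture implies `(C4EW)(2,3)`**: `p·π² ≠ q·log 2·log 3` for all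
`p, q ≥ 1`. [Waldschmidt 2008, Conjecture 12 ⇒ (C4EW); Nesterenko–Philippon 2001, Ch. 2 §4.1] -/
theorem soloInformed_c4ew23_of_fourExponentials (h4 : FourExponentialsConjecture) :
    SoloInformedC4EW23 := by
  intro p q hp hq hrel
  have hlog2 : Real.log 2 ≠ 0 := (Real.log_pos one_lt_two).ne'
  have hpR : (p : ℝ) ≠ 0 := Nat.cast_ne_zero.2 hp
  -- the two pairs
  set x : Fin 2 → ℂ := ![((Real.log 2 : ℝ) : ℂ), (Real.pi : ℂ) * I] with hx
  set y : Fin 2 → ℂ := ![((1 : ℝ) : ℂ), ((Real.pi / Real.log 2 : ℝ) : ℂ) * I] with hy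
  have hxli : LinearIndependent ℚ x :=
    soloInformed_linearIndependent_real_imaginary _ _ hlog2 Real.pi_ne_zero
  have hyli : LinearIndependent ℚ y :=
    soloInformed_linearIndependent_real_imaginary _ _ one_ne_zero (div_ne_zero Real.pi_ne_zero hlog2)
  obtain ⟨i, j, hij⟩ := h4 x y hxli hyli
  -- the four products
  have e00 : x 0 * y 0 = ((Real.log 2 : ℝ) : ℂ) := by
    simp [hx, hy]
  have e01 : x 0 * y 1 = Real.pi * I := by
    simp only [hx, hy, Matrix.cons_val_zero, Matrix.cons_val_one]
    have : ((Real.log 2 : ℝ) : ℂ) * ((Real.pi / Real.log 2 : ℝ) : ℂ) = (Real.pi : ℂ) := by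
      rw [← Complex.ofReal_mul]
      congr 1
      field_simp
    rw [← mul_assoc, this]
  have e10 : x 1 * y 0 = Real.pi * I := by
    simp [hx, hy]
  have e11 : x 1 * y 1 = ((-(q * Real.log 3 / p) : ℝ) : ℂ) := by
    simp only [hx, hy, Matrix.cons_val_one, Matrix.cons_val_zero]
    have hI : (Real.pi : ℂ) * I * (((Real.pi / Real.log 2 : ℝ) : ℂ) * I) =
        -((Real.pi : ℂ) * ((Real.pi / Real.log 2 : ℝ) : ℂ)) := by
      have : I * I = -1 := Complex.I_mul_I
      linear_combination (Real.pi : ℂ) * ((Real.pi / Real.log 2 : ℝ) : ℂ) * this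
    rw [hI, ← Complex.ofReal_mul, ← Complex.ofReal_neg]
    congr 1
    have : Real.pi * (Real.pi / Real.log 2) = q * Real.log 3 / p := by
      field_simp
      linear_combination hrel
    rw [this]
  -- the real number `t = e^{−q log 3 / p}` with `t ^ p = 3^{−q}`
  set t : ℝ := Real.exp (-(q * Real.log 3 / p)) with ht
  have htp : t ^ p = (((3 : ℚ) ^ q)⁻¹ : ℚ) := by
    rw [ht, ← Real.exp_nat_mul]
    have : (p : ℝ) * -(q * Real.log 3 / p) = -((q : ℝ) * Real.log 3) := by field_simp
    rw [this, Real.exp_neg, Real.exp_nat_mul, Real.exp_log (by norm_num : (0 : ℝ) < 3)]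
    push_cast
    rfl
  have halg : IsAlgebraic ℚ (cexp (x i * y j)) := by
    fin_cases i <;> fin_cases j
    · -- `e^{log 2} = 2`
      show IsAlgebraic ℚ (cexp (x 0 * y 0))
      rw [e00, ← Complex.ofReal_exp, Real.exp_log (by norm_num : (0 : ℝ) < 2)]
      exact soloInformed_isAlgebraic_of_pow_eq_ratCast 2 1 one_ne_zero 2 (by norm_num)
    · show IsAlgebraic ℚ (cexp (x 0 * y 1))
      rw [e01]
      exact soloInformed_isAlgebraic_exp_pi_mul_I
    · show IsAlgebraic ℚ (cexp (x 1 * y 0))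
      rw [e10]
      exact soloInformed_isAlgebraic_exp_pi_mul_I
    · -- `e^{−π²/log 2} = 3^{−q/p}`
      show IsAlgebraic ℚ (cexp (x 1 * y 1))
      rw [e11, ← Complex.ofReal_exp]
      exact soloInformed_isAlgebraic_of_pow_eq_ratCast t p hp _ htp
  exact hij halg

/-- Hence the four exponentials conjecture implies the non-relation of the calculus on the instance:
`p·[D̄]·[D̄] − q·[L₂]·[L₃] ∉ relations` (kernel composition with `soloInformed_noRelation_of_c4ew`). -/
theorem soloInformed_noRelation_of_fourExponentials (h4 : FourExponentialsConjecture) :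
    SoloInformedTorusBoxNoRelation :=
  soloInformed_noRelation_of_c4ew (soloInformed_c4ew23_of_fourExponentials h4)

/-- And the localised non-relation: `⟦[π]⟧ⁿ · ⟦p·[D̄]·[D̄] − q·[L₂]·[L₃]⟧ ≠ 0` in `FormalRep ⧸ relations`
(kernel composition with `soloInformed_noLocRelation_of_c4ew`). -/
theorem soloInformed_noLocRelation_of_fourExponentials (h4 : FourExponentialsConjecture) :
    SoloInformedTorusBoxNoLocRelation :=
  soloInformed_noLocRelation_of_c4ew (soloInformed_c4ew23_of_fourExponentials h4)

end Summit.KontsevichZagierPeriods.KontsevichZagierPeriods.Theorems
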